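import Summits.ResolutionOfSingularities.ResolutionOfSingularities.Theorems.FrobeniusClosingPatchingRelPerfectDepthPermissibleEquimultiple
import Literature.AlgebraicGeometry.Resolution.RegularLocalRingsUFD
import Mathlib.RingTheory.Radical.Basic
import Literature.AlgebraicGeometry.Resolution.StalkIdealLemmas
import Literature.AlgebraicGeometry.Resolution.MarkedIdealsLemmas
import Literature.AlgebraicGeometry.Resolution.BlowupChartMembership
import HarnessLib

/-!
# Crux `PatchingRelPerfect` (stmt-ResolutionOfSingularities-16161), chain W5.2 — F7(β) (β-AX) T3 extraction glue, LAYER A (ring):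
# the extraction lemma keyed on the RADICAL ideal of a host product

[OURS · L1 W5.2 · F7(β) (β-AX) · res-L1-w52-plan-1 NAMING G12-12 «(EQ-glue)», layer A] res-L1-w52-stub-1 g5.  Replaces the role of NO printed
item; NOT a statement of the manuscript under review (AI-written, weaker than expert review).

The v7 `StepStable` binder `hperm` is permissibility of the centre inside the REDUCED total host trace `D`, whose stalk ideal at a point is the
RADICAL `√(f)` of the product `f = ∏ fᵢ` of the local host equations — not a named generator.  This file re-keys the extraction lemma
(`…DepthPermissibleEquimultiple`, p558158/p559205/p559881/p560819) on that radical so that the scheme-level consumer (layer B,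
`…DepthTraceEquimultiple`) never has to name a generator:

* `radical_span_singleton_eq_span_radical` — in a factorial domain `√(f) = (rad f)` (`UniqueFactorizationMonoid.radical`; Mathlib's
  `exists_dvd_pow_iff_radical_dvd`), `exists_radical_span_singleton_eq_span` — in a regular local ring `√(f) = (h)` with `h ≠ 0` and `f ∣ hᴺ`;
* **`mOrder_eq_mOrder_localization_of_dvd_of_radical`** — S regular local, `p` prime with `S ⧸ p` regular, `f ∈ p ∖ 0`, `𝔞 = √(f)`,
  `(p.map (mk 𝔞)).IsPermissible`, `g ∣ f` ⟹ `ord_𝔪 g = ord_{S_p} g` (every local host equation is equimultiple along the centre);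
* `isUnit_of_dvd_of_radical_of_not_mem` — … and `g ∉ p` ⟹ `g` is a unit («a host trace not containing the centre misses the point»).

Fact-free (Auslander–Buchsbaum `uniqueFactorizationMonoid_of_isRegularLocalRing` is a tree theorem).
-/

-- `Summit.<Summit>.<Sub>.Theorems` with `Sub = Summit` (single-conjunct summit, D-0017)
set_option linter.dupNamespace false

noncomputable section

open IsLocalRing
open Literature.RingTheory.HilbertSamuel

namespace Summit.ResolutionOfSingularities.ResolutionOfSingularities.Theorems.DepthEquimultiple

universe u

variable {S : Type u} [CommRing S]

/-- **In a factorial domain the radical of a principal ideal is principal**, generated by the radical of the generator (Mathlib's TODO in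
`RingTheory/Radical/Basic`). [folklore] -/
theorem radical_span_singleton_eq_span_radical [IsDomain S] [NormalizationMonoid S] [UniqueFactorizationMonoid S] {f : S} (hf : f ≠ 0) :
    (Ideal.span {f}).radical = Ideal.span {UniqueFactorizationMonoid.radical f} := by
  ext y
  rw [Ideal.mem_span_singleton, ← UniqueFactorizationMonoid.exists_dvd_pow_iff_radical_dvd hf]
  refine ⟨fun ⟨n, hn⟩ => ⟨n, Ideal.mem_span_singleton.mp hn⟩, fun ⟨n, hn⟩ => ⟨n, Ideal.mem_span_singleton.mpr hn⟩⟩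

/-- **In a regular local ring the radical of a non-zero principal ideal is principal**: `√(f) = (h)` with `h ≠ 0` and `f ∣ hᴺ` for some `N`.
[cite: Matsumura1987, Thm. 20.3] -/
theorem exists_radical_span_singleton_eq_span [IsRegularLocalRing S] {f : S} (hf : f ≠ 0) :
    ∃ h : S, h ≠ 0 ∧ (Ideal.span {f}).radical = Ideal.span {h} ∧ ∃ N : ℕ, f ∣ h ^ N := by
  haveI : IsDomain S := Literature.AlgebraicGeometry.Resolution.isDomain_of_isRegularLocalRing S
  haveI : UniqueFactorizationMonoid S := Literature.AlgebraicGeometry.Resolution.uniqueFactorizationMonoid_of_isRegularLocalRing S inferInstance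
  letI : StrongNormalizationMonoid S := UniqueFactorizationMonoid.strongNormalizationMonoid
  refine ⟨UniqueFactorizationMonoid.radical f, fun h0 => hf ?_, radical_span_singleton_eq_span_radical hf,
    UniqueFactorizationMonoid.exists_dvd_radical_self_pow hf⟩
  exact zero_dvd_iff.mp (h0 ▸ UniqueFactorizationMonoid.radical_dvd_self)


/-- Core of the divisor step (self-contained over instalment 3 of `…DepthPermissibleEquimultiple`): if `g * q = h ^ N` with `h` equimultiple
along `p`, then `g` is equimultiple along `p` (orders add on both sides, the generic order never exceeds the special one termwise).
[cite: CossartJannsenSaito2020, Thm. 3.3] -/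
theorem mOrder_eq_mOrder_localization_of_mul_eq_pow [IsRegularLocalRing S] (p : Ideal S) [p.IsPrime] {h g q : S} {N : ℕ} (h0 : h ≠ 0)
    (hEQ : mOrder h = mOrder (algebraMap S (Localization.AtPrime p) h)) (hgq : g * q = h ^ N) :
    mOrder g = mOrder (algebraMap S (Localization.AtPrime p) g) := by
  classical
  haveI : IsDomain S := Literature.AlgebraicGeometry.Resolution.isDomain_of_isRegularLocalRing S
  haveI : IsRegularRing S := Literature.AlgebraicGeometry.Resolution.isRegularRing_of_isRegularLocalRing S
  set φ := algebraMap S (Localization.AtPrime p) with hφ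
  have hN0 : h ^ N ≠ 0 := pow_ne_zero N h0
  have hg0 : g ≠ 0 := fun e => hN0 (by rw [← hgq, e, zero_mul])
  have hq0 : q ≠ 0 := fun e => hN0 (by rw [← hgq, e, mul_zero])
  have hpow : ∀ (T : Type u) [CommRing T] [IsRegularLocalRing T] (x : T) (n : ℕ), mOrder (x ^ n) = n * mOrder x := by
    intro T _ _ x n
    induction n with
    | zero => rw [pow_zero, Nat.cast_zero, zero_mul]; exact mOrder_eq_zero_of_isUnit isUnit_one
    | succ n ih => rw [pow_succ, mOrder_mul, ih, Nat.cast_succ, add_mul, one_mul]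
  have hsum : mOrder g + mOrder q = mOrder (φ g) + mOrder (φ q) := by
    rw [← mOrder_mul, ← mOrder_mul, ← map_mul, hgq, map_pow, hpow, hpow, hEQ]
  have key := eq_of_sum_eq_of_le (Finset.univ : Finset Bool) (a := fun b => if b then mOrder g else mOrder q)
    (b := fun b => if b then mOrder (φ g) else mOrder (φ q)) (fun b _ => by cases b <;> exact mOrder_localization_le p _)
    (fun b _ => by cases b <;> simp only [Bool.false_eq_true, if_false, if_true, Ne, mOrder_eq_top_iff_eq_zero] <;> assumption)
    (by simpa only [Fintype.sum_bool, if_true, if_false, Bool.false_eq_true] using hsum)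
  simpa only [if_true] using key true (Finset.mem_univ true)

/-- [OURS · L1 W5.2 · F7(β) (β-AX) T3 extraction glue, layer A] **Every divisor of the host product is equimultiple along a centre that is
permissible inside the REDUCED host trace.**  S regular local, `p` prime with `S ⧸ p` regular, `f ∈ p`, `f ≠ 0`, `𝔞 = √(f)` (the stalk of the
reduced trace), `p/𝔞` permissible in `S/𝔞`; then every `g ∣ f` has `ord_𝔪 g = ord_{S_p} g`. [cite: CossartJannsenSaito2020, Thm. 3.3] -/
theorem mOrder_eq_mOrder_localization_of_dvd_of_radical [IsRegularLocalRing S] (p : Ideal S) [p.IsPrime] [IsRegularLocalRing (S ⧸ p)]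
    {f : S} (hfp : f ∈ p) (hf0 : f ≠ 0) {𝔞 : Ideal S} (h𝔞 : 𝔞 = (Ideal.span {f}).radical)
    (hperm : (p.map (Ideal.Quotient.mk 𝔞)).IsPermissible) {g : S} (hg : g ∣ f) :
    mOrder g = mOrder (algebraMap S (Localization.AtPrime p) g) := by
  obtain ⟨h, h0, hrad, N, hN⟩ := exists_radical_span_singleton_eq_span hf0
  rw [hrad] at h𝔞
  subst h𝔞
  -- `h ∈ p`: `h ∈ √(f) ⊆ √p = p`
  have hh : h ∈ p := by
    have : h ∈ (Ideal.span {f}).radical := by rw [hrad]; exact Ideal.mem_span_singleton_self h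
    exact (Ideal.IsPrime.radical_le_iff inferInstance).mpr ((Ideal.span_singleton_le_iff_mem _).mpr hfp) this
  obtain ⟨q, hq⟩ := hg.trans hN
  exact mOrder_eq_mOrder_localization_of_mul_eq_pow p h0 (mOrder_eq_mOrder_localization_of_isPermissible p hh h0 hperm) hq.symm

/-- … and such a divisor lying outside `p` is a unit: a host trace that does not contain the centre misses the point. [folklore] -/
theorem isUnit_of_dvd_of_radical_of_not_mem [IsRegularLocalRing S] (p : Ideal S) [p.IsPrime] [IsRegularLocalRing (S ⧸ p)] {f : S}
    (hfp : f ∈ p) (hf0 : f ≠ 0) {𝔞 : Ideal S} (h𝔞 : 𝔞 = (Ideal.span {f}).radical) (hperm : (p.map (Ideal.Quotient.mk 𝔞)).IsPermissible)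
    {g : S} (hg : g ∣ f) (hgp : g ∉ p) : IsUnit g := by
  obtain ⟨h, h0, hrad, N, hN⟩ := exists_radical_span_singleton_eq_span hf0
  rw [hrad] at h𝔞
  subst h𝔞
  have hh : h ∈ p := by
    have : h ∈ (Ideal.span {f}).radical := by rw [hrad]; exact Ideal.mem_span_singleton_self h
    exact (Ideal.IsPrime.radical_le_iff inferInstance).mpr ((Ideal.span_singleton_le_iff_mem _).mpr hfp) this
  obtain ⟨q, hq⟩ := hg.trans hN
  have h1 : mOrder (algebraMap S (Localization.AtPrime p) g) = 0 :=
    mOrder_eq_zero_of_isUnit ((IsLocalization.AtPrime.isUnit_to_map_iff (Localization.AtPrime p) p g).mpr hgp)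
  have h2 : mOrder g = 0 := by
    rw [mOrder_eq_mOrder_localization_of_mul_eq_pow p h0 (mOrder_eq_mOrder_localization_of_isPermissible p hh h0 hperm) hq.symm, h1]
  by_contra hu
  have hm : g ∈ maximalIdeal S ^ 1 := by rw [pow_one]; exact (IsLocalRing.mem_maximalIdeal g).mpr hu
  have := (le_mOrder_iff g 1).mpr hm
  rw [h2] at this
  exact absurd this (by decide)

/-- The finite-product form: each factor of `f = ∏ᵢ fᵢ` is equimultiple along the centre. [cite: CossartJannsenSaito2020, Thm. 3.3] -/
theorem mOrder_eq_mOrder_localization_of_mem_prod_of_radical [IsRegularLocalRing S] (p : Ideal S) [p.IsPrime] [IsRegularLocalRing (S ⧸ p)]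
    {ι : Type*} (s : Finset ι) (f : ι → S) (hf0 : ∀ i ∈ s, f i ≠ 0) (hfp : ∏ i ∈ s, f i ∈ p) {𝔞 : Ideal S}
    (h𝔞 : 𝔞 = (Ideal.span {∏ i ∈ s, f i}).radical) (hperm : (p.map (Ideal.Quotient.mk 𝔞)).IsPermissible) {i : ι} (hi : i ∈ s) :
    mOrder (f i) = mOrder (algebraMap S (Localization.AtPrime p) (f i)) :=
  haveI : IsDomain S := Literature.AlgebraicGeometry.Resolution.isDomain_of_isRegularLocalRing S
  mOrder_eq_mOrder_localization_of_dvd_of_radical p hfp (Finset.prod_ne_zero_iff.mpr hf0) h𝔞 hperm (Finset.dvd_prod_of_mem f hi)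

/-! ## Layer B (rev 2, append-only): the SCHEME-LEVEL reading on a family of effective Cartier traces

At a point `x` of a scheme `Z` with regular local ring `𝒪_{Z,x}`: effective Cartier «host traces» `tr i` (finitely many), the reduced total
trace `D = ⋃ i, Supp (tr i)` (a closed set, pinned by this equation as in the v7 `StepStable` binder `hD`), a centre ideal `C ⊇ 𝓘(D)` (`hsub`)
whose stalk at `x` is a prime with regular quotient, and the v7 permissibility binder `hperm` at `x`.  Then every local equation of every
trace is EQUIMULTIPLE along the centre at `x`, and a trace whose equation is not in `C_x` misses `x`. -/

section Scheme

open CategoryTheory AlgebraicGeometry TopologicalSpace Literature.AlgebraicGeometry.Resolution Scheme.IdealSheafData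

universe v

variable {Z : Scheme.{v}}

/-- Stalks of a finite product of ideal sheaves (function-indexed). [folklore] -/
theorem stalkIdeal_prod {ι : Type*} (s : Finset ι) (I : ι → Z.IdealSheafData) (x : Z) :
    stalkIdeal (∏ i ∈ s, I i) x = ∏ i ∈ s, stalkIdeal (I i) x := by
  classical
  induction s using Finset.induction_on with
  | empty => rw [Finset.prod_empty, Finset.prod_empty, one_eq_top, stalkIdeal_top, Ideal.one_eq_top]
  | insert a s ha ih => rw [Finset.prod_insert ha, Finset.prod_insert ha, stalkIdeal_mul, ih]

/-- Support of a finite product of ideal sheaves (function-indexed). [folklore] -/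
theorem coe_support_prod {ι : Type*} (s : Finset ι) (I : ι → Z.IdealSheafData) :
    ((∏ i ∈ s, I i).support : Set Z) = ⋃ i ∈ s, ((I i).support : Set Z) := by
  classical
  induction s using Finset.induction_on with
  | empty => rw [Finset.prod_empty, one_eq_top, support_top]; simp
  | insert a s ha ih =>
    rw [Finset.prod_insert ha, support_mul, TopologicalSpace.Closeds.coe_sup, ih]
    simp

/-- [OURS · L1 W5.2 · F7(β) (β-AX) T3 extraction glue, layer B] **Every host trace is equimultiple along a centre that is v7-permissible
inside the reduced total trace.**  Hypotheses = the v7 `StepStable` binder texts read at one point `x` (any index type, any scheme; `𝒪_{Z,x}`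
regular, `C_x` prime with regular quotient): for every `i` and every generator `g` of `(tr i)_x`, `ord_𝔪 g = ord_{C_x} g` — the order of the
trace at `x` equals its order at the generic point of the centre through `x`. [cite: CossartJannsenSaito2020, Thm. 3.3] -/
theorem trace_mOrder_eq_mOrder_localization {ι : Type*} [Fintype ι] (tr : ι → Z.IdealSheafData) (htr : ∀ i, IsEffectiveCartier (tr i))
    (D : Closeds Z) (hD : (D : Set Z) = ⋃ i, ((tr i).support : Set Z)) (C : Z.IdealSheafData) (hsub : vanishingIdeal D ≤ C) {x : Z}
    [IsRegularLocalRing (Z.presheaf.stalk x)] [(stalkIdeal C x).IsPrime] [IsRegularLocalRing ((Z.presheaf.stalk x) ⧸ stalkIdeal C x)]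
    (hperm : ((stalkIdeal C x).map (Ideal.Quotient.mk (stalkIdeal (vanishingIdeal D) x))).IsPermissible)
    (i : ι) {g : Z.presheaf.stalk x} (hg : stalkIdeal (tr i) x = Ideal.span {g}) :
    mOrder g = mOrder (algebraMap (Z.presheaf.stalk x) (Localization.AtPrime (stalkIdeal C x)) g) := by
  classical
  haveI : IsDomain (Z.presheaf.stalk x) := Literature.AlgebraicGeometry.Resolution.isDomain_of_isRegularLocalRing _
  -- local equations of all the traces
  choose f hf0 hf using fun j => (htr j).exists_stalkIdeal_eq_span x
  -- the reduced total trace is the support of the product, its stalk ideal the radical of the product of the local equations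
  have hDprod : D = (∏ j, tr j).support := by
    apply TopologicalSpace.Closeds.ext
    rw [hD, coe_support_prod]; simp
  have h𝔞 : stalkIdeal (vanishingIdeal D) x = (Ideal.span {∏ j, f j}).radical := by
    rw [hDprod, vanishingIdeal_support, stalkIdeal_radical, stalkIdeal_prod, ← Ideal.prod_span_singleton]
    exact congrArg _ (Finset.prod_congr rfl fun j _ => hf j)
  have hF0 : ∏ j, f j ≠ 0 := Finset.prod_ne_zero_iff.mpr fun j _ => nonZeroDivisors.ne_zero (hf0 j)
  have hFp : ∏ j, f j ∈ stalkIdeal C x := by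
    have h1 : ∏ j, f j ∈ stalkIdeal (vanishingIdeal D) x := by rw [h𝔞]; exact Ideal.le_radical (Ideal.mem_span_singleton_self _)
    exact stalkIdeal_mono hsub x h1
  -- `g` is associated with `f i`, a factor of the product
  have hgf : g ∣ ∏ j, f j := by
    have : f i ∈ Ideal.span {g} := by rw [← hg, hf i]; exact Ideal.mem_span_singleton_self _
    exact (Ideal.mem_span_singleton.mp this).trans (Finset.dvd_prod_of_mem f (Finset.mem_univ i))
  exact mOrder_eq_mOrder_localization_of_dvd_of_radical (stalkIdeal C x) hFp hF0 h𝔞 hperm hgf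

/-- [OURS · layer B] **A host trace whose local equation is not in `C_x` misses `x`** (its equation is a unit, `(tr i)_x = ⊤`, `x ∉ Supp (tr i)`).
[folklore] -/
theorem trace_stalkIdeal_eq_top_of_not_le {ι : Type*} [Fintype ι] (tr : ι → Z.IdealSheafData) (htr : ∀ i, IsEffectiveCartier (tr i))
    (D : Closeds Z) (hD : (D : Set Z) = ⋃ i, ((tr i).support : Set Z)) (C : Z.IdealSheafData) (hsub : vanishingIdeal D ≤ C) {x : Z}
    [IsRegularLocalRing (Z.presheaf.stalk x)] [(stalkIdeal C x).IsPrime] [IsRegularLocalRing ((Z.presheaf.stalk x) ⧸ stalkIdeal C x)]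
    (hperm : ((stalkIdeal C x).map (Ideal.Quotient.mk (stalkIdeal (vanishingIdeal D) x))).IsPermissible)
    (i : ι) (hi : ¬ stalkIdeal (tr i) x ≤ stalkIdeal C x) : stalkIdeal (tr i) x = ⊤ ∧ x ∉ (tr i).support := by
  classical
  haveI : IsDomain (Z.presheaf.stalk x) := Literature.AlgebraicGeometry.Resolution.isDomain_of_isRegularLocalRing _
  choose f hf0 hf using fun j => (htr j).exists_stalkIdeal_eq_span x
  have hDprod : D = (∏ j, tr j).support := by
    apply TopologicalSpace.Closeds.ext
    rw [hD, coe_support_prod]; simp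
  have h𝔞 : stalkIdeal (vanishingIdeal D) x = (Ideal.span {∏ j, f j}).radical := by
    rw [hDprod, vanishingIdeal_support, stalkIdeal_radical, stalkIdeal_prod, ← Ideal.prod_span_singleton]
    exact congrArg _ (Finset.prod_congr rfl fun j _ => hf j)
  have hF0 : ∏ j, f j ≠ 0 := Finset.prod_ne_zero_iff.mpr fun j _ => nonZeroDivisors.ne_zero (hf0 j)
  have hFp : ∏ j, f j ∈ stalkIdeal C x := by
    have h1 : ∏ j, f j ∈ stalkIdeal (vanishingIdeal D) x := by rw [h𝔞]; exact Ideal.le_radical (Ideal.mem_span_singleton_self _)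
    exact stalkIdeal_mono hsub x h1
  have hfi : f i ∉ stalkIdeal C x := fun h => hi (by rw [hf i, Ideal.span_singleton_le_iff_mem]; exact h)
  have hu : IsUnit (f i) := isUnit_of_dvd_of_radical_of_not_mem (stalkIdeal C x) hFp hF0 h𝔞 hperm
    (Finset.dvd_prod_of_mem f (Finset.mem_univ i)) hfi
  have htop : stalkIdeal (tr i) x = ⊤ := by rw [hf i, Ideal.span_singleton_eq_top]; exact hu
  refine ⟨htop, fun hx => ?_⟩
  have := (mem_support_iff_stalkIdeal_le (tr i) x).mp hx
  rw [htop, top_le_iff] at this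
  exact (IsLocalRing.maximalIdeal.isMaximal _).ne_top this

end Scheme

end Summit.ResolutionOfSingularities.ResolutionOfSingularities.Theorems.DepthEquimultiple

end
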